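import Mathlib
import HarnessLib
import Summits.Ventures.LatticeQCDFlow.Exactness.NCMCGeneralSpaceConditionalMeanCLT
import Summits.Ventures.LatticeQCDFlow.Exactness.NCMCGeneralSpaceOccupancyChainEveryStart

/-!
# CLT-width error bars for the NCMC lane's target-level means: from EVERY initial state, `√n (Σ_target g / #target − Z₁⁻¹∫g dν₁) ⇒ N(0, σ²_f / σ(c − ΔF)²)`

HONEST FRAMING: exact (Metropolis-corrected) sampling algorithms for lattice gauge theory;
figures of merit are autocorrelation/cost numbers at stated couplings and volumes; no
continuum-physics claim.

Venture `LatticeQCDFlow` (cell pub-lqcd), topic `Exactness`; FANOUT row 13 (`eng-snf`, GEN-19).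
NEW WORK of the cell, not a published result; no definition is introduced; nothing is cited as a
fact.  ASSEMBLY: GEN-19's conditional-mean (ratio) CLT under a Doeblin power
(`NCMCGeneralSpaceConditionalMeanCLT.tendstoInDistribution_condMean_of_nHit`) on the iteration kernel
`Q = switchKernel κF κR c W s e ∘ₖ levelKernel T₀ T₁` of `run_ncmc_chain` with GEN-18's two-step
certificate, the event being the target level and the observable a bounded measurable function `g` of
the configuration; GEN-17/18's bookkeeping of the joint weight (`integral_jointLaw`,
`integral_jointWeight_targetLevel_indicator`, `jointWeight_targetLevel`, `jointLaw_real_targetLevel`)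
identifies the conditional mean with the normalised target expectation `Z₁⁻¹ ∫ g dν₁` and the event
mass with `σ(c − ΔF)`.  GEN-18 (`NCMCGeneralSpaceOccupancyChainEveryStart`) proved the almost sure
convergence of these `target_means` from every start; this file gives their Gaussian fluctuations.

## Content (Crooks pair from `ν₀` to `ν₁` (finite, non-zero), level samplers leaving `ν₀`, `ν₁`
## invariant, `ε • ν ≤ nHit Q 2 z` for all `z` (`ε ≠ 0`), `e^{−ΔF} = Z₁/Z₀`, `|g| ≤ C` measurable,
## `m = Z₁⁻¹ ∫ g dν₁`, `f(p) = (g(p.2) − m) · 1_target(p)`, `σ²_f = ∫ f² dπ_c + 2 Σ_{k≥0} ∫ f · Q^{k+1} f dπ_c`)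

* `ncmc_targetLevel_condMean_eq` — `(∫ 1_target g dπ_c)/π_c(target) = Z₁⁻¹ ∫ g dν₁`.
* **`CrooksPair.ncmc_targetLevelMean_clt_of_sq`** — for every initial state `z` and every
  `Y ~ N(0, σ²_f / σ(c − ΔF)²)`:
  `TendstoInDistribution (fun n x => √n (Σ_{i<n} 1_target g (x_i) / Σ_{i<n} 1_target(x_i) − m)) atTop Y (fun _ => P_{δ_z}) P'`;
  **`CrooksPair.ncmc_targetLevelMean_clt_of_exists_sq`** — from an existential certificate.

NOT CLAIMED: unbounded `g` (GEN-18's consistency needs only `g ∈ L¹(ν₁)`; the CLT here needs `g`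
bounded); a plug-in variance; rates; anything numerical.
-/

namespace Summit.Ventures.LatticeQCDFlow.Exactness.GeneralNCMC

open MeasureTheory ProbabilityTheory Set Filter Finset
open scoped ENNReal Topology

section NCMC

variable {Ω E : Type*} [MeasurableSpace Ω] [MeasurableSpace E]
  {ν₀ ν₁ : Measure Ω} [IsFiniteMeasure ν₀] [IsFiniteMeasure ν₁]
  {κF κR : Kernel Ω E} [IsMarkovKernel κF] [IsMarkovKernel κR] {s e : E → Ω} {W : E → ℝ} {c : ℝ}
  {T₀ T₁ : Kernel Ω Ω} [IsMarkovKernel T₀] [IsMarkovKernel T₁] {ε : ℝ≥0∞}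
  {ν : Measure (Bool × Ω)} [IsProbabilityMeasure ν]
  {Ω' : Type*} [MeasurableSpace Ω'] {P' : Measure Ω'} [IsProbabilityMeasure P'] {Y : Ω' → ℝ}

omit [MeasurableSpace E] [IsFiniteMeasure ν₀] in
/-- **The conditional mean on the target level is the normalised target expectation**:
`(∫ 1_target g dπ_c) / π_c(target) = Z₁⁻¹ ∫ g dν₁` (`ν₀ ≠ 0 ≠ ν₁`). -/
theorem ncmc_targetLevel_condMean_eq [IsFiniteMeasure ν₀] (h0 : ν₀ univ ≠ 0) (h1 : ν₁ univ ≠ 0)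
    {g : Ω → ℝ} (hgm : Measurable g) (hg : Integrable g ν₁) :
    (∫ p, (targetLevel Ω).indicator (fun p : Bool × Ω => g p.2) p
        ∂((jointWeight c ν₀ ν₁ univ)⁻¹ • jointWeight c ν₀ ν₁))
      / ((jointWeight c ν₀ ν₁ univ)⁻¹ • jointWeight c ν₀ ν₁).real (targetLevel Ω)
      = ((ν₁ univ).toReal)⁻¹ * ∫ y, g y ∂ν₁ := by
  haveI := isFiniteMeasure_jointWeight c ν₀ ν₁
  have hJ : 0 < (jointWeight c ν₀ ν₁ univ).toReal :=
    ENNReal.toReal_pos (jointWeight_univ_ne_zero c ν₀ ν₁ h0) (measure_ne_top _ _)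
  have hz1 : 0 < (ν₁ univ).toReal := ENNReal.toReal_pos h1 (measure_ne_top ν₁ univ)
  have ha : ∫ p, (targetLevel Ω).indicator (fun p : Bool × Ω => g p.2) p
      ∂((jointWeight c ν₀ ν₁ univ)⁻¹ • jointWeight c ν₀ ν₁) =
      ((jointWeight c ν₀ ν₁ univ).toReal)⁻¹ * (Real.exp c * ∫ y, g y ∂ν₁) := by
    rw [integral_jointLaw, integral_jointWeight_targetLevel_indicator c ν₀ ν₁ hgm hg]
  have hb : ((jointWeight c ν₀ ν₁ univ)⁻¹ • jointWeight c ν₀ ν₁).real (targetLevel Ω) =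
      ((jointWeight c ν₀ ν₁ univ).toReal)⁻¹ * (Real.exp c * (ν₁ univ).toReal) := by
    rw [measureReal_def, Measure.smul_apply, smul_eq_mul, ENNReal.toReal_mul, ENNReal.toReal_inv,
      jointWeight_targetLevel, ENNReal.toReal_mul, ENNReal.toReal_ofReal (Real.exp_pos c).le]
  rw [ha, hb]
  have hec : Real.exp c ≠ 0 := Real.exp_ne_zero c
  field_simp

/-- **THE TARGET-LEVEL-MEAN CLT FROM EVERY INITIAL STATE.**  Under a two-step minorisation
`ε • ν ≤ (nHit Q 2)(z, ·)` (`ε ≠ 0`), for a bounded measurable observable `g` of the configuration,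
`m = Z₁⁻¹ ∫ g dν₁`, `f = (g ∘ snd − m) · 1_target` and `σ²_f` its Green–Kubo variance under `(Q, π_c)`:
for every initial state `z` and every `Y ~ N(0, σ²_f / σ(c − ΔF)²)`, `√n (target mean of g − m)`
converges in distribution to `Y` under `P_{δ_z}`. -/
theorem CrooksPair.ncmc_targetLevelMean_clt_of_sq (h : CrooksPair ν₀ ν₁ κF κR s e W)
    (h0 : ν₀ univ ≠ 0) (h1 : ν₁ univ ≠ 0) (hT₀ : Kernel.Invariant T₀ ν₀)
    (hT₁ : Kernel.Invariant T₁ ν₁) (hε : ε ≠ 0)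
    (hD : haveI := isMarkovKernel_switchKernel (κF := κF) (κR := κR) (c := c)
              h.measurable_W h.measurable_s h.measurable_e
      ∀ z, ε • ν ≤ nHit (switchKernel κF κR c W s e ∘ₖ levelKernel T₀ T₁) 2 z)
    {ΔF : ℝ} (hΔF : Real.exp (-ΔF) = ((ν₀ univ)⁻¹ * ν₁ univ).toReal)
    {g : Ω → ℝ} (hgm : Measurable g) {C : ℝ} (hgC : ∀ x, |g x| ≤ C) (z : Bool × Ω)
    (hY : haveI := isMarkovKernel_switchKernel (κF := κF) (κR := κR) (c := c)
              h.measurable_W h.measurable_s h.measurable_e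
      HasLaw Y (gaussianReal 0 (Real.toNNReal (
        ((∫ p, ((g p.2 - ((ν₁ univ).toReal)⁻¹ * ∫ y, g y ∂ν₁)
            * (targetLevel Ω).indicator (1 : Bool × Ω → ℝ) p) ^ 2
            ∂((jointWeight c ν₀ ν₁ univ)⁻¹ • jointWeight c ν₀ ν₁))
          + 2 * ∑' k, ∫ p, ((g p.2 - ((ν₁ univ).toReal)⁻¹ * ∫ y, g y ∂ν₁)
              * (targetLevel Ω).indicator (1 : Bool × Ω → ℝ) p)
            * (Scoring.kop (switchKernel κF κR c W s e ∘ₖ levelKernel T₀ T₁))^[k + 1]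
              (fun p => (g p.2 - ((ν₁ univ).toReal)⁻¹ * ∫ y, g y ∂ν₁)
                * (targetLevel Ω).indicator (1 : Bool × Ω → ℝ) p) p
              ∂((jointWeight c ν₀ ν₁ univ)⁻¹ • jointWeight c ν₀ ν₁))
        / Real.sigmoid (c - ΔF) ^ 2))) P')
    [hP : haveI := isMarkovKernel_switchKernel (κF := κF) (κR := κR) (c := c)
              h.measurable_W h.measurable_s h.measurable_e
      haveI := isMarkovKernel_levelKernel T₀ T₁
      IsProbabilityMeasure (Kernel.trajMeasure (X := fun _ : ℕ => Bool × Ω) (Measure.dirac z)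
        (fun n : ℕ => (switchKernel κF κR c W s e ∘ₖ levelKernel T₀ T₁).comap
          (fun hh : (j : ↥(Finset.Iic n)) → Bool × Ω => hh ⟨n, Finset.mem_Iic.2 le_rfl⟩)
          (measurable_pi_apply _)))] :
    haveI := isMarkovKernel_switchKernel (κF := κF) (κR := κR) (c := c)
      h.measurable_W h.measurable_s h.measurable_e
    haveI := isMarkovKernel_levelKernel T₀ T₁
    TendstoInDistribution (fun (n : ℕ) (x : ℕ → Bool × Ω) =>
        Real.sqrt n * ((∑ i ∈ range n, (targetLevel Ω).indicator (fun p : Bool × Ω => g p.2) (x i)) /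
            (∑ i ∈ range n, (targetLevel Ω).indicator (1 : Bool × Ω → ℝ) (x i))
          - ((ν₁ univ).toReal)⁻¹ * ∫ y, g y ∂ν₁))
      atTop Y (fun _ => Kernel.trajMeasure (X := fun _ : ℕ => Bool × Ω) (Measure.dirac z)
        (fun n : ℕ => (switchKernel κF κR c W s e ∘ₖ levelKernel T₀ T₁).comap
          (fun hh : (j : ↥(Finset.Iic n)) → Bool × Ω => hh ⟨n, Finset.mem_Iic.2 le_rfl⟩)
          (measurable_pi_apply _))) P' := by
  haveI := isMarkovKernel_switchKernel (κF := κF) (κR := κR) (c := c)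
    h.measurable_W h.measurable_s h.measurable_e
  haveI := isMarkovKernel_levelKernel T₀ T₁
  haveI := isProbabilityMeasure_jointLaw c ν₀ ν₁ h0
  have hπ : Kernel.Invariant (switchKernel κF κR c W s e ∘ₖ levelKernel T₀ T₁)
      ((jointWeight c ν₀ ν₁ univ)⁻¹ • jointWeight c ν₀ ν₁) :=
    invariant_smul _ (iteration_invariant h hT₀ hT₁ c) _
  have hσ := jointLaw_real_targetLevel c ν₀ ν₁ h0 h1 hΔF
  have hp0 : 0 < ((jointWeight c ν₀ ν₁ univ)⁻¹ • jointWeight c ν₀ ν₁).real (targetLevel Ω) := by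
    rw [hσ]; exact Real.sigmoid_pos _
  have hg2m : Measurable fun p : Bool × Ω => g p.2 := hgm.comp measurable_snd
  have hg2C : ∀ p : Bool × Ω, |g p.2| ≤ C := fun p => hgC p.2
  have hmean := ncmc_targetLevel_condMean_eq (c := c) h0 h1 hgm
    (Scoring.integrable_of_bounded ν₁ hgm hgC)
  have hclt := tendstoInDistribution_condMean_of_nHit hπ hε hD (by norm_num)
    measurableSet_targetLevel hp0 hg2m hg2C (Measure.dirac z) (Y := Y) (P' := P')
  rw [hmean, hσ] at hclt
  exact hclt hY

/-- **From an existential two-step certificate: the target-level-mean CLT from every initial state.** -/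
theorem CrooksPair.ncmc_targetLevelMean_clt_of_exists_sq (h : CrooksPair ν₀ ν₁ κF κR s e W)
    (h0 : ν₀ univ ≠ 0) (h1 : ν₁ univ ≠ 0) (hT₀ : Kernel.Invariant T₀ ν₀)
    (hT₁ : Kernel.Invariant T₁ ν₁)
    (hex : ∃ (ε : ℝ≥0∞) (ν : Measure (Bool × Ω)), IsProbabilityMeasure ν ∧ ε ≠ 0 ∧
      ∀ z, ε • ν ≤ nHit (switchKernel κF κR c W s e ∘ₖ levelKernel T₀ T₁) 2 z)
    {ΔF : ℝ} (hΔF : Real.exp (-ΔF) = ((ν₀ univ)⁻¹ * ν₁ univ).toReal)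
    {g : Ω → ℝ} (hgm : Measurable g) {C : ℝ} (hgC : ∀ x, |g x| ≤ C) (z : Bool × Ω)
    (hY : haveI := isMarkovKernel_switchKernel (κF := κF) (κR := κR) (c := c)
              h.measurable_W h.measurable_s h.measurable_e
      HasLaw Y (gaussianReal 0 (Real.toNNReal (
        ((∫ p, ((g p.2 - ((ν₁ univ).toReal)⁻¹ * ∫ y, g y ∂ν₁)
            * (targetLevel Ω).indicator (1 : Bool × Ω → ℝ) p) ^ 2
            ∂((jointWeight c ν₀ ν₁ univ)⁻¹ • jointWeight c ν₀ ν₁))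
          + 2 * ∑' k, ∫ p, ((g p.2 - ((ν₁ univ).toReal)⁻¹ * ∫ y, g y ∂ν₁)
              * (targetLevel Ω).indicator (1 : Bool × Ω → ℝ) p)
            * (Scoring.kop (switchKernel κF κR c W s e ∘ₖ levelKernel T₀ T₁))^[k + 1]
              (fun p => (g p.2 - ((ν₁ univ).toReal)⁻¹ * ∫ y, g y ∂ν₁)
                * (targetLevel Ω).indicator (1 : Bool × Ω → ℝ) p) p
              ∂((jointWeight c ν₀ ν₁ univ)⁻¹ • jointWeight c ν₀ ν₁))
        / Real.sigmoid (c - ΔF) ^ 2))) P')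
    [hP : haveI := isMarkovKernel_switchKernel (κF := κF) (κR := κR) (c := c)
              h.measurable_W h.measurable_s h.measurable_e
      haveI := isMarkovKernel_levelKernel T₀ T₁
      IsProbabilityMeasure (Kernel.trajMeasure (X := fun _ : ℕ => Bool × Ω) (Measure.dirac z)
        (fun n : ℕ => (switchKernel κF κR c W s e ∘ₖ levelKernel T₀ T₁).comap
          (fun hh : (j : ↥(Finset.Iic n)) → Bool × Ω => hh ⟨n, Finset.mem_Iic.2 le_rfl⟩)
          (measurable_pi_apply _)))] :
    haveI := isMarkovKernel_switchKernel (κF := κF) (κR := κR) (c := c)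
      h.measurable_W h.measurable_s h.measurable_e
    haveI := isMarkovKernel_levelKernel T₀ T₁
    TendstoInDistribution (fun (n : ℕ) (x : ℕ → Bool × Ω) =>
        Real.sqrt n * ((∑ i ∈ range n, (targetLevel Ω).indicator (fun p : Bool × Ω => g p.2) (x i)) /
            (∑ i ∈ range n, (targetLevel Ω).indicator (1 : Bool × Ω → ℝ) (x i))
          - ((ν₁ univ).toReal)⁻¹ * ∫ y, g y ∂ν₁))
      atTop Y (fun _ => Kernel.trajMeasure (X := fun _ : ℕ => Bool × Ω) (Measure.dirac z)
        (fun n : ℕ => (switchKernel κF κR c W s e ∘ₖ levelKernel T₀ T₁).comap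
          (fun hh : (j : ↥(Finset.Iic n)) → Bool × Ω => hh ⟨n, Finset.mem_Iic.2 le_rfl⟩)
          (measurable_pi_apply _))) P' := by
  obtain ⟨ε, ν, hν, hε, hD⟩ := hex
  haveI := hν
  exact h.ncmc_targetLevelMean_clt_of_sq h0 h1 hT₀ hT₁ hε hD hΔF hgm hgC z hY

end NCMC

end Summit.Ventures.LatticeQCDFlow.Exactness.GeneralNCMC
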